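import Literature.Topology.PlanarFoliations.StarGate
import Literature.Topology.PlanarFoliations.ProngStarEnds
import HarnessLib

/-!
# The gate fence on the band side is the image of a planar leaf arc

Topic: Topology / PlanarFoliations, sequel to `StarGate.lean`, `ProngStarEnds.lean`. At a level
`τ` with `h = χ τ ≠ 0` and `j' = nb j h` (the sector into which the planar leaves of `S j` at
height `h` continue across the axis), the horizontal of the gate fence `gateFence j j' β₀ χ` is
the image under `g ∘ ι` of the **planar gate path** `gateΨ`: the horizontal of `S j` at height
`h` from `b = β₀` to the axis, (a pause at) the axis point, and the horizontal of `S j'` from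
the axis to `b = β₀` — a path of `X` continuous in the leaf topology of the planar foliation,
hence running in one planar leaf (`gateFence_eq_of_nb`, `continuous_toLeafSpace_gateΨ`,
`gateΨ_mem_leaf`). This is the identification of the band-side horizontals of the fences over
walks with the planar leaves tracking the walk around its corners.

* generic lemmas on `transFence`: `transFence_map`, `transFence_congr`, `continuous_transFence_apply`
  (**proved**);
* `StarData.gateΨ` (**definition**), `gateΨ_zero`, `gateΨ_one`, `gateFence_eq_of_nb`,
  `continuous_toLeafSpace_gateΨ`, `gateΨ_mem_leaf` (**proved**).

## References

* C. Camacho, A. Lins Neto, *Geometric Theory of Foliations*, Birkhäuser (1985), Ch. VII §2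
  [CamachoLinsNeto1985].
-/

noncomputable section

open Set Filter Function Metric unitInterval
open _root_.Topology
open Literature.Topology.FourManifolds Literature.Topology.FourManifolds.Foliation

namespace Literature.Topology.PlanarFoliations

/-! ## Generic lemmas on concatenated fences -/

section TransFence

variable {Y Y' : Type*} {Φ₁ Φ₂ Φ₁' Φ₂' : I → ℝ → Y}

/-- Post-composition commutes with concatenation. [folklore] -/
theorem transFence_map (f : Y → Y') (Φ₁ Φ₂ : I → ℝ → Y) (θ : I) (τ : ℝ) :
    transFence (fun θ τ ↦ f (Φ₁ θ τ)) (fun θ τ ↦ f (Φ₂ θ τ)) θ τ = f (transFence Φ₁ Φ₂ θ τ) := by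
  unfold transFence; split_ifs <;> rfl

/-- Concatenation at a level only depends on the two pieces at that level. [folklore] -/
theorem transFence_congr {τ : ℝ} (h₁ : ∀ θ, Φ₁ θ τ = Φ₁' θ τ) (h₂ : ∀ θ, Φ₂ θ τ = Φ₂' θ τ) (θ : I) :
    transFence Φ₁ Φ₂ θ τ = transFence Φ₁' Φ₂' θ τ := by
  unfold transFence; split_ifs <;> simp [h₁, h₂]

/-- **The horizontal of a concatenation is continuous** when the horizontals of the pieces are and
agree at the junction. [folklore] -/
theorem continuous_transFence_apply [TopologicalSpace Y] {τ : ℝ} (h₁ : Continuous fun θ ↦ Φ₁ θ τ)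
    (h₂ : Continuous fun θ ↦ Φ₂ θ τ) (hj : Φ₁ 1 τ = Φ₂ 0 τ) : Continuous fun θ ↦ transFence Φ₁ Φ₂ θ τ := by
  have h : Continuous fun θ : I ↦ if (θ : ℝ) ≤ 1 / 2 then Φ₁ (fstHalf θ) τ else Φ₂ (sndHalf θ) τ := by
    refine Continuous.if_le (h₁.comp continuous_fstHalf) (h₂.comp continuous_sndHalf) continuous_subtype_val
      continuous_const fun θ hθ ↦ ?_
    rw [fstHalf_eq_one hθ, sndHalf_eq_zero hθ, hj]
  exact h.congr fun θ ↦ by unfold transFence; split_ifs <;> rfl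

end TransFence

variable {X : Type*} [TopologicalSpace X] [Nonempty X] {F : Foliation ℝ X} {ι : X → ℂ}
variable {B : Type*} [NormedAddCommGroup B] [NormedSpace ℝ B] {M : Type*} [TopologicalSpace M]
  {T : Foliation B M} {g : ℂ → M}

namespace StarData

variable (D : StarData F ι T g) (hι : IsOpenEmbedding ι) {v : ℂ} (hv : D.nprong v ≠ 0)

/-! ## The planar gate path -/

/-- **The planar gate path**: horizontal of `S j` at height `χ τ` from `β₀` to the axis, the axis
point, horizontal of `S j'` from the axis to `β₀`. [folklore] -/
def gateΨ (j j' : ZMod (D.nprong v)) (β₀ : ℝ) (χ : ℝ ≃o ℝ) : I → ℝ → X :=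
  transFence (transFence (fun θ τ ↦ (D.star v hv).horiz hι j (χ τ) (βline β₀ 0 θ))
    (fun _ τ ↦ (D.star v hv).horiz hι j (χ τ) 0)) (fun θ τ ↦ (D.star v hv).horiz hι j' (χ τ) (βline 0 β₀ θ))

variable {j j' : ZMod (D.nprong v)} {β₀ : ℝ} {χ : ℝ ≃o ℝ} {τ : ℝ}

omit [NormedSpace ℝ B] in
/-- The planar gate path starts over `pt j (β₀, χ τ)`. [folklore] -/
theorem gateΨ_zero (τ : ℝ) : D.gateΨ hι hv j j' β₀ χ 0 τ = (D.star v hv).horiz hι j (χ τ) β₀ := by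
  rw [gateΨ, transFence_zero, transFence_zero, βline_zero]

omit [NormedSpace ℝ B] in
/-- The planar gate path ends over `pt j' (β₀, χ τ)`. [folklore] -/
theorem gateΨ_one (τ : ℝ) : D.gateΨ hι hv j j' β₀ χ 1 τ = (D.star v hv).horiz hι j' (χ τ) β₀ := by
  rw [gateΨ, transFence_one, βline_one]

/-- **On the band side the gate fence is the image of the planar gate path**: at a level `τ` with
`χ τ ≠ 0` in `[-ρ, ρ]` and `j' = nb j (χ τ)`. [folklore] -/
theorem gateFence_eq_of_nb (hβ₀ : β₀ ∈ Icc 0 (D.star v hv).ρ) (hh : χ τ ∈ Icc (-(D.star v hv).ρ) (D.star v hv).ρ)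
    (hh0 : χ τ ≠ 0) (hj' : j' = (D.star v hv).nb j (χ τ)) (θ : I) :
    D.gateFence hv j j' β₀ χ θ τ = g (ι (D.gateΨ hι hv j j' β₀ χ θ τ)) := by
  have h0 : (0 : ℝ) ∈ Icc 0 (D.star v hv).ρ := ⟨le_rfl, (D.star v hv).ρ_pos.le⟩
  have hrect : ∀ {β : ℝ}, β ∈ Icc 0 (D.star v hv).ρ → (β, χ τ) ∈ (D.star v hv).rect := fun hβ ↦ ((D.star v hv).mem_rect_iff).2 ⟨hβ, hh⟩
  have hne : ∀ β : ℝ, ((β, χ τ) : ℝ × ℝ) ≠ 0 := fun β h ↦ hh0 (by simpa using congrArg Prod.snd h)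
  -- the axis points agree
  have haxis : (D.star v hv).pt j' (0, χ τ) = (D.star v hv).pt j (0, χ τ) := by rw [hj']; exact (D.star v hv).pt_nb_zero hh
  -- unfold both sides as concatenations
  show D.gateFence hv j j' β₀ χ θ τ = (g ∘ ι) (D.gateΨ hι hv j j' β₀ χ θ τ)
  simp only [gateΨ, ← transFence_map (g ∘ ι), gateFence]
  refine transFence_congr (fun θ' ↦ transFence_congr (fun θ'' ↦ ?_) (fun θ'' ↦ ?_) θ') (fun θ' ↦ ?_) θ
  · -- first sector piece
    show g ((D.star v hv).pt j (βline β₀ 0 θ'', χ τ)) = g (ι ((D.star v hv).horiz hι j (χ τ) (βline β₀ 0 θ'')))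
    rw [(D.star v hv).ι_horiz hι (hrect (βline_mem hβ₀ h0 θ'')) (hne _)]
  · -- the middle slide is constant, equal to the image of the axis point
    have hlev : (D.box v (g ((D.star v hv).pt j (0, χ τ)))).2 = D.gateIso hv χ τ := by
      rw [gateIso_apply]; exact D.level_pt_eq_levelIso hv j (hrect h0)
    have hsrc : g ((D.star v hv).pt j (0, χ τ)) ∈ (D.box v).source := D.mapsTo_S hv j ((D.star v hv).pt_mem (hrect h0))
    show slideFence (D.box v) (D.gateIso hv χ) (D.gateT₁ hv j χ) (D.gateT₂ hv j' χ) θ'' τ =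
      g (ι ((D.star v hv).horiz hι j (χ τ) 0))
    rw [(D.star v hv).ι_horiz hι (hrect h0) (hne _), slideFence, slideB]
    simp only [gateT₁, gateT₂]
    rw [haxis]
    rw [← add_smul, sub_add_cancel, one_smul, ← hlev, Prod.mk.eta, (D.box v).left_inv hsrc]
  · -- second sector piece
    show g ((D.star v hv).pt j' (βline 0 β₀ θ', χ τ)) = g (ι ((D.star v hv).horiz hι j' (χ τ) (βline 0 β₀ θ')))
    rw [(D.star v hv).ι_horiz hι (hrect (βline_mem h0 hβ₀ θ')) (hne _)]

omit [NormedSpace ℝ B] in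
/-- **The planar gate path is continuous in the leaf topology** (at a level with `χ τ ≠ 0` in
`[-ρ, ρ]` and `j' = nb j (χ τ)`). [folklore] -/
theorem continuous_toLeafSpace_gateΨ (hβ₀ : β₀ ∈ Icc 0 (D.star v hv).ρ)
    (hh : χ τ ∈ Icc (-(D.star v hv).ρ) (D.star v hv).ρ) (hh0 : χ τ ≠ 0) (hj' : j' = (D.star v hv).nb j (χ τ)) :
    Continuous (toLeafSpace ∘ fun θ ↦ D.gateΨ hι hv j j' β₀ χ θ τ : I → F.LeafSpace) := by
  have h0 : (0 : ℝ) ∈ Icc 0 (D.star v hv).ρ := ⟨le_rfl, (D.star v hv).ρ_pos.le⟩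
  have hne : ∀ β : ℝ, ((β, χ τ) : ℝ × ℝ) ≠ 0 := fun β h ↦ hh0 (by simpa using congrArg Prod.snd h)
  have hT : ∀ β ∈ Icc 0 (D.star v hv).ρ, (β, χ τ) ∈ (D.star v hv).rect ∧ ((β, χ τ) : ℝ × ℝ) ≠ 0 := fun β hβ ↦
    ⟨((D.star v hv).mem_rect_iff).2 ⟨hβ, hh⟩, hne β⟩
  have hcont : ∀ (k : ZMod (D.nprong v)) {βa βb : ℝ}, βa ∈ Icc 0 (D.star v hv).ρ → βb ∈ Icc 0 (D.star v hv).ρ →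
      Continuous (toLeafSpace ∘ fun θ : I ↦ (D.star v hv).horiz hι k (χ τ) (βline βa βb θ) : I → F.LeafSpace) := by
    intro k βa βb ha hb
    have h := ((D.star v hv).continuousOn_toLeafSpace_horiz hι (j := k) hT).comp_continuous (continuous_βline βa βb)
      fun θ ↦ βline_mem ha hb θ
    exact h
  have haxis : (D.star v hv).horiz hι j' (χ τ) 0 = (D.star v hv).horiz hι j (χ τ) 0 := by rw [hj']; exact (D.star v hv).horiz_nb_zero hι hh
  show Continuous fun θ ↦ toLeafSpace (D.gateΨ hι hv j j' β₀ χ θ τ)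
  simp only [gateΨ, ← transFence_map (toLeafSpace : X → F.LeafSpace)]
  refine continuous_transFence_apply (continuous_transFence_apply (hcont j hβ₀ h0) continuous_const ?_) (hcont j' h0 hβ₀) ?_
  · show toLeafSpace ((D.star v hv).horiz hι j (χ τ) (βline β₀ 0 1)) = toLeafSpace ((D.star v hv).horiz hι j (χ τ) 0)
    rw [βline_one]
  · rw [transFence_one]
    show toLeafSpace ((D.star v hv).horiz hι j (χ τ) 0) = toLeafSpace ((D.star v hv).horiz hι j' (χ τ) (βline 0 β₀ 0))
    rw [βline_zero, haxis]

omit [NormedSpace ℝ B] in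
/-- **The planar gate path runs in one leaf.** [folklore] -/
theorem gateΨ_mem_leaf (hβ₀ : β₀ ∈ Icc 0 (D.star v hv).ρ) (hh : χ τ ∈ Icc (-(D.star v hv).ρ) (D.star v hv).ρ)
    (hh0 : χ τ ≠ 0) (hj' : j' = (D.star v hv).nb j (χ τ)) (θ : I) :
    D.gateΨ hι hv j j' β₀ χ θ τ ∈ F.leaf (D.gateΨ hι hv j j' β₀ χ 0 τ) :=
  F.mem_leaf_of_continuous_toLeafSpace (D.continuous_toLeafSpace_gateΨ hι hv hβ₀ hh hh0 hj') 0 θ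

end StarData

end Literature.Topology.PlanarFoliations
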